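import Mathlib.Data.Nat.Totient
import Literature.Computability.Cryptography.ShorOrderFindingAnalysis
import HarnessLib

/-!
# Boneh–Lipton period finding read out by Kitaev's Hadamard tests, II: the query-free hit test

Topic `Literature/Computability/QuantumComplexity`; second analysis file behind the discharge of
`Literature.Barriers.QuantumAdvantage.aaronsonChen2017_lem75_quantum` (Aaronson–Chen 2017,
Lemma 7.5 (2)–(3)). The printed distinguisher (App. 13, p. 42) "tries to recover a period `a` …
and accepts only if `f(1) = f(1+a)`" — an oracle query AFTER the classical post-processing, which
the tree's classical wrap of uniform oracle families (`exists_uniform_classicalWrap_rel`, oracle-free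
post-processor) does not offer. This file replaces the re-query by a test on the Fourier sample
`u ∈ [0, N)` alone, `N = 2^b`, with the moduli range `[⌊√N⌋/4, ⌊√N⌋/2]` of Zhandry's `PRF^mod`
(`Cryptography/ZhandryPRFMod.lean`):

* `Hit N u` — some `q` in the range has a fraction `p/q` STRICTLY within `1/2N` of `u/N`
  (decidable);
* `card_filter_hit_le`, `eight_mul_sum_Icc_le` — at most `∑_q (q+1) ≤ N/8 + O(√N)` samples hit:
  a UNIFORM sample (the case of a permutation table) hits with probability `≤ 1/8 + O(N^{-1/2})`;
* `hit_of_good` — Shor's good outcomes `round(dN/a)` of an odd `a` in the range hit;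
* `exists_threshold_hit_mass` — for large `b` and an odd prime `a` in the range the hitting samples
  carry mass `≥ (a-1)/3a` under `u ↦ ∑_{k<a} P(u, k)` (`Shor1997.totient_div_le_sum_outcomeProb`
  with `n = ⌊√N⌋`).

## References

* P. W. Shor, SIAM J. Comput. 26 (1997), §5 ("Counting the good states") [Shor1997].
* S. Aaronson, L. Chen, CCC 2017, arXiv:1612.05903, §7.2 (the moduli set), App. 13 [AaronsonChen2017].
-/

noncomputable section

namespace Literature.Computability.QuantumComplexity

namespace PeriodFinding

open Finset Literature.Computability.Cryptography

variable {N : ℕ}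

/-! ### The candidate range and the hit test -/

/-- Lower end `⌊√N⌋/4` of the candidate periods (the moduli of Zhandry's `PRF^mod` are the
primes in `[√N/4, √N/2]`). [cite: AaronsonChen2017, §7.2 (p. 29)] -/
def qLo (N : ℕ) : ℕ := Nat.sqrt N / 4

/-- Upper end `⌊√N⌋/2` of the candidate periods. [cite: AaronsonChen2017, §7.2 (p. 29)] -/
def qHi (N : ℕ) : ℕ := Nat.sqrt N / 2

/-- **The hit test** on a Fourier sample `u ∈ [0, N)`: some candidate period `q ∈ [⌊√N⌋/4, ⌊√N⌋/2]`
has a fraction `p/q` STRICTLY within `1/2N` of `u/N`, i.e. `2|uq - pN| < q`. It replaces the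
oracle re-query "accept only if `f(1) = f(1+a)`" of the printed distinguisher (Aaronson–Chen 2017,
App. 13) by a test on the sample alone: rare for a uniform sample (`card_filter_hit_le`), and
passed by Shor's good outcomes of a period in the range (`hit_of_good`). [folklore] -/
def Hit (N u : ℕ) : Prop :=
  ∃ q ∈ Icc (qLo N) (qHi N), ∃ p ∈ range (q + 1), 2 * |(u : ℤ) * q - p * N| < q

/-- The hit test is decidable (bounded quantifiers). [folklore] -/
instance Hit.decidable (N u : ℕ) : Decidable (Hit N u) := by
  unfold Hit; infer_instance

/-! ### A uniform sample rarely hits -/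

/-- Two integers strictly within `1/2` of the same real multiple `pN/q` coincide: the set of
`u` with `2|uq - pN| < q` has at most one element. [folklore] -/
theorem eq_of_two_mul_abs_lt {q : ℕ} {p : ℤ} {u u' : ℤ} (hu : 2 * |u * q - p * N| < q)
    (hu' : 2 * |u' * q - p * N| < q) : u = u' := by
  have hq : (0 : ℤ) < q := by
    have := abs_nonneg (u * q - p * N); omega
  have h1 : |(u - u') * q| < q := by
    have htri : |(u * q - p * N) - (u' * q - p * N)| ≤ |u * q - p * N| + |u' * q - p * N| :=
      abs_sub _ _
    rw [show (u - u') * (q : ℤ) = (u * q - p * N) - (u' * q - p * N) by ring]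
    omega
  rw [abs_mul, Nat.abs_cast] at h1
  have h2 : |u - u'| < 1 := by
    by_contra h
    push Not at h
    have : (q : ℤ) ≤ |u - u'| * q := le_mul_of_one_le_left hq.le h
    omega
  have h3 : |u - u'| = 0 := by
    have := abs_nonneg (u - u'); omega
  rwa [abs_eq_zero, sub_eq_zero] at h3

/-- **A uniform sample rarely hits**: the number of `u < N` passing the hit test is at most
`∑_{q ∈ [⌊√N⌋/4, ⌊√N⌋/2]} (q + 1)` (one `u` per fraction `p/q`, `0 ≤ p ≤ q`). [folklore] -/
theorem card_filter_hit_le (N : ℕ) :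
    ((range N).filter (Hit N)).card ≤ ∑ q ∈ Icc (qLo N) (qHi N), (q + 1) := by
  classical
  have hsub : (range N).filter (Hit N) ⊆ (Icc (qLo N) (qHi N)).biUnion fun q =>
      (range (q + 1)).biUnion fun p =>
        (range N).filter fun u => 2 * |(u : ℤ) * q - p * N| < q := by
    intro u hu
    rw [mem_filter] at hu
    obtain ⟨huN, q, hq, p, hp, h⟩ := hu
    exact mem_biUnion.2 ⟨q, hq, mem_biUnion.2 ⟨p, hp, mem_filter.2 ⟨huN, h⟩⟩⟩
  refine (card_le_card hsub).trans ((card_biUnion_le).trans (sum_le_sum fun q _ => ?_))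
  refine (card_biUnion_le).trans ?_
  calc ∑ p ∈ range (q + 1), ((range N).filter fun u : ℕ => 2 * |(u : ℤ) * q - p * N| < q).card
      ≤ ∑ _p ∈ range (q + 1), 1 := by
        refine sum_le_sum fun p _ => Finset.card_le_one.2 fun u hu u' hu' => ?_
        rw [mem_filter] at hu hu'
        exact_mod_cast eq_of_two_mul_abs_lt (p := p) hu.2 hu'.2
    _ = q + 1 := by simp

/-- The size of that bound: `8 ∑_{q ∈ [⌊√N⌋/4, ⌊√N⌋/2]} (q + 1) ≤ N + 10⌊√N⌋ + 16`, i.e. a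
uniform sample hits with probability at most `1/8 + O(N^{-1/2})`. [folklore] -/
theorem eight_mul_sum_Icc_le (N : ℕ) :
    8 * ∑ q ∈ Icc (qLo N) (qHi N), (q + 1) ≤ N + 10 * Nat.sqrt N + 16 := by
  set s := Nat.sqrt N with hs
  have hss : s * s ≤ N := Nat.sqrt_le N
  have hA : 4 * (s / 4) ≤ s := Nat.mul_div_le s 4
  have hA' : s < 4 * (s / 4) + 4 := by omega
  have hB : 2 * (s / 2) ≤ s := Nat.mul_div_le s 2
  have h1 : ∑ q ∈ Icc (qLo N) (qHi N), (q + 1) ≤ (qHi N + 1 - qLo N) * (qHi N + 1) := by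
    calc ∑ q ∈ Icc (qLo N) (qHi N), (q + 1) ≤ ∑ _q ∈ Icc (qLo N) (qHi N), (qHi N + 1) :=
          sum_le_sum fun q hq => by have := (mem_Icc.1 hq).2; omega
      _ = (qHi N + 1 - qLo N) * (qHi N + 1) := by rw [sum_const, Nat.card_Icc, smul_eq_mul]
  have h2 : qHi N + 1 - qLo N ≤ s / 4 + 2 := by unfold qHi qLo; omega
  have h3 : qHi N + 1 ≤ s / 2 + 1 := by unfold qHi; omega
  calc 8 * ∑ q ∈ Icc (qLo N) (qHi N), (q + 1) ≤ 8 * ((s / 4 + 2) * (s / 2 + 1)) := by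
        have := Nat.mul_le_mul h2 h3
        omega
    _ ≤ N + 10 * s + 16 := by nlinarith

/-! ### Shor's good outcomes hit -/

/-- **Good outcomes hit.** If `a` is odd and lies in the candidate range, every outcome `c` with
`2|ac - dN| ≤ a` for some `d ≤ a` (Shor's good outcome `c = round(dN/a)`,
`Shor1997.two_mul_abs_round_le`) passes the hit test — with the fraction `d/a` itself; the
inequality is strict because its left side is even. [cite: Shor1997, §5 (counting the good states)] -/
theorem hit_of_good {a d c : ℕ} (ha : Odd a) (h1 : qLo N ≤ a) (h2 : a ≤ qHi N) (hd : d ≤ a)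
    (h : 2 * |(a : ℤ) * c - d * N| ≤ a) : Hit N c := by
  refine ⟨a, mem_Icc.2 ⟨h1, h2⟩, d, mem_range.2 (Nat.lt_succ_of_le hd), ?_⟩
  rw [mul_comm (c : ℤ)]
  rcases h.lt_or_eq with hlt | heq
  · exact hlt
  · exfalso
    have heven : Even (a : ℤ) := ⟨|(a : ℤ) * c - d * N|, by omega⟩
    exact (Nat.not_even_iff_odd.2 ha) (Int.even_coe_nat a |>.1 heven)

/-- **The mass of the hitting outcomes under Shor's distribution.** For every large power of two
`N = 2^b` and every odd prime `a` in the candidate range, the outcomes passing the hit test carry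
total weight at least `(a-1)/3a` under `u ↦ ∑_{k<a} P(u, k)` (Shor 1997, §5: the `φ(a) = a - 1`
fractions `d/a`, `0 < d < a`, have good outcomes of probability `≥ 1/3a²` for each of the `a`
residues; `Shor1997.totient_div_le_sum_outcomeProb` with `n = ⌊√N⌋`, `n² ≤ N < 2n²`).
[cite: Shor1997, §5 (counting the good states)] -/
theorem exists_threshold_hit_mass :
    ∃ b₀ : ℕ, ∀ b : ℕ, b₀ ≤ b → ∀ a : ℕ, a.Prime → Odd a → qLo (2 ^ b) ≤ a → a ≤ qHi (2 ^ b) →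
      ((a : ℝ) - 1) / (3 * a) ≤
        ∑ u ∈ (range (2 ^ b)).filter (Hit (2 ^ b)), ∑ k ∈ range a, Shor1997.outcomeProb (2 ^ b) a k u := by
  classical
  obtain ⟨n₀, hn₀⟩ := Shor1997.totient_div_le_sum_outcomeProb
  refine ⟨(max n₀ 3) ^ 2, fun b hb a hap hao h1 h2 => ?_⟩
  set N := 2 ^ b with hN
  set n := Nat.sqrt N with hn
  have hbN : b < N := Nat.lt_two_pow_self
  have hn3 : max n₀ 3 ≤ n := by
    rw [hn, Nat.le_sqrt]
    calc max n₀ 3 * max n₀ 3 = (max n₀ 3) ^ 2 := (sq _).symm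
      _ ≤ N := by omega
  have hnn : n * n ≤ N := Nat.sqrt_le N
  have hNn : N < (n + 1) * (n + 1) := Nat.lt_succ_sqrt N
  have hq1 : n ^ 2 ≤ N := by rw [sq]; exact hnn
  have hq2 : N < 2 * n ^ 2 := by
    have h3 : 3 ≤ n := le_trans (le_max_right _ _) hn3
    nlinarith
  have hapos : 0 < a := hap.pos
  have han : a < n := by
    have : a ≤ n / 2 := h2
    have h3 : 3 ≤ n := le_trans (le_max_right _ _) hn3
    omega
  have key := hn₀ n N a (le_trans (le_max_left _ _) hn3) hq1 hq2 ⟨b, rfl⟩ hapos han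
  rw [Nat.totient_prime hap] at key
  push_cast [hap.one_le] at key
  refine key.trans ?_
  rw [sum_comm]
  refine sum_le_sum_of_subset_of_nonneg (fun c hc => ?_) fun c _ _ => sum_nonneg fun k _ => ?_
  · rw [mem_filter] at hc ⊢
    obtain ⟨hcN, d, hda, -, hd⟩ := hc
    exact ⟨hcN, hit_of_good hao h1 h2 hda.le hd⟩
  · unfold Shor1997.outcomeProb; positivity

end PeriodFinding

end Literature.Computability.QuantumComplexity

end
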